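import Mathlib
import Summits.Ventures.PercRepro.TriangleCapThreeRowStability

/-!
# PercRepro — THE SECOND-BEST VALUE OF THE `K₄⁻`-FREE CHERRY TABLE ON THE ROW `a = 3`, EVERY CELL
`(k, 3, r)` WITH `r ≥ 1` AND `k ≥ r + 7`: `2 (k − 7)` below the closed form at `r = 1` (the one-triangle family),
`B1(r) = 2 max(1, r − 2)` below for `r ≥ 2` (the matching at `r = 2`, the broom for `r ≥ 3`) (p3, gen 43; part 192)

`secondGapThree k r` is the gap. `three_row_second_best_bound`: every `K₄⁻`-free graph on the cell that is NOT
extremal is at least `secondGapThree k r` below `m k − r (k − 1 − r)` — a `3`-bipartite one by parts 184–186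
(a single missing pair is a star, so at `r = 1` it is extremal; `closed_form_stability_bipSub_two` at `r = 2`;
`closed_form_stability_bipSub` for `r ≥ 3`), any other by part 191 (`2 (k − 7) ≥ B1`).
`three_row_second_best_attained`: the gap is attained — by `tFamily` (part 189) at `r = 1`, by
`K_{3,k−3}` minus a matching of two cross pairs at `r = 2` (`delEdge (bipMinusStar k 3 1) 1 (k − 1)`), by the broom
(`broom_value`, part 186) for `r ≥ 3`. `three_row_second_best` states both halves: THE SECOND-BEST VALUE OF
`Σ_v d(v)²` OVER THE NON-EXTREMAL `K₄⁻`-FREE GRAPHS ON THE CELL IS EXACTLY `m k − r (k − 1 − r) − secondGapThree k r`.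
Axioms: standard.
-/

namespace PercRepro

namespace TriangleCap

namespace C047

open Finset

variable {V : Type*} [Fintype V] [DecidableEq V]

/-- The second-best gap of the row `a = 3`: `2 (k − 7)` at `r = 1`, `B1(r) = 2 max(1, r − 2)` for `r ≥ 2`. -/
def secondGapThree (k r : ℕ) : ℕ := if r = 1 then 2 * (k - 7) else 2 * max 1 (r - 2)

/-- A spanning subgraph of `K(A, Aᶜ)` with exactly one missing cross pair has a missing star. -/
theorem exists_missingStar_of_one (D : SimpleGraph V) [DecidableRel D.Adj] (A : Finset V) (hA : BipSub D A)
    [Nonempty V] (a : ℕ) (hAcard : A.card = a) (hm : D.edgeFinset.card + 1 = a * (Fintype.card V - a)) :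
    ∃ v, MissingStar D A v := by
  apply missingStar_of_pairwiseAdjacent D A
  intro e he f hf hef
  exfalso
  have h1 := card_edges_missingGraph D A hA a 1 hAcard hm
  have h2 : e = f := card_le_one.mp (by rw [h1]) e he f hf
  exact hef h2

/-- **THE BOUND:** on the cell `(k, 3, r)`, `r ≥ 1`, `k ≥ r + 7`, a `K₄⁻`-free graph that is not extremal is at
least `secondGapThree k r` below the closed form. -/
theorem three_row_second_best_bound (D : SimpleGraph V) [DecidableRel D.Adj] (hK : K4mFree D) (r : ℕ)
    (hr : 1 ≤ r) (hk : r + 7 ≤ Fintype.card V) (hm : D.edgeFinset.card + 9 + r = 3 * Fintype.card V)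
    (hne : ∑ v, deg D v * deg D v + r * (Fintype.card V - 1 - r) ≠ D.edgeFinset.card * Fintype.card V) :
    ∑ v, deg D v * deg D v + r * (Fintype.card V - 1 - r) + secondGapThree (Fintype.card V) r ≤
      D.edgeFinset.card * Fintype.card V := by
  have hE3 : D.edgeFinset.card + r = 3 * (Fintype.card V - 3) := by omega
  have hne' : Nonempty V := Fintype.card_pos_iff.mp (by omega)
  by_cases hb : ∃ A : Finset V, A.card = 3 ∧ BipSub D A
  · obtain ⟨A, hAcard, hA⟩ := hb
    have hnostar : ¬ ∃ v, MissingStar D A v := by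
      rintro ⟨v, hv⟩
      exact hne (closed_form_eq_of_missingStar D A hA hv 3 r hAcard hE3 (by omega))
    unfold secondGapThree
    rcases Nat.lt_or_ge r 2 with hr1 | hr2
    · -- `r = 1`: a single missing pair is a star
      exfalso
      have hr1' : r = 1 := by omega
      rw [hr1'] at hE3
      exact hnostar (exists_missingStar_of_one D A hA 3 hAcard hE3)
    rcases Nat.lt_or_ge r 3 with hr2' | hr3
    · -- `r = 2`: the matching bound `+ 2`
      have hr2'' : r = 2 := by omega
      subst hr2''
      have h := closed_form_stability_bipSub_two D A hA 3 hAcard hE3 (by omega) hnostar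
      rw [if_neg (by omega)]
      simpa using h
    · -- `r ≥ 3`: `+ 2 (r − 2)`
      have h := closed_form_stability_bipSub D A hA 3 r hAcard hE3 (by omega) (by omega) hnostar
      rw [if_neg (by omega)]
      have hmax : max 1 (r - 2) = r - 2 := max_eq_right (by omega)
      rw [hmax]
      exact h
  · -- not `3`-bipartite: part 191
    have h := three_row_second_order_pos D hK r hr hk hm hb
    unfold secondGapThree
    split_ifs with h1
    · exact h
    · have : 2 * max 1 (r - 2) ≤ 2 * (Fintype.card V - 7) := by
        apply Nat.mul_le_mul_left
        rw [max_le_iff]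
        omega
      omega

/-- `K_{3,k−3}` minus a matching of two cross pairs: the edge `{0, 3}` (the star of `bipMinusStar n 3 1`) and
the edge `{1, n − 1}`. -/
abbrev matchingTwo (n : ℕ) (hn : 2 ≤ n) : SimpleGraph (Fin n) :=
  delEdge (bipMinusStar n 3 1) ⟨1, by omega⟩ ⟨n - 1, by omega⟩

/-- **THE MATCHING WITNESS AT `r = 2`:** `K₄⁻`-free, `3 (n − 3) − 2` edges,
`Σ_v d(v)² + 2 (n − 1 − 2) + 2 = m n` (for `n ≥ 6`). -/
theorem matchingTwo_value (n : ℕ) (hn : 6 ≤ n) :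
    K4mFree (matchingTwo n (by omega)) ∧ (matchingTwo n (by omega)).edgeFinset.card + 9 + 2 = 3 * n ∧
      ∑ v, deg (matchingTwo n (by omega)) v * deg (matchingTwo n (by omega)) v + 2 * (n - 1 - 2) + 2 =
        (matchingTwo n (by omega)).edgeFinset.card * n := by
  have hadj : (bipMinusStar n 3 1).Adj ⟨1, by omega⟩ ⟨n - 1, by omega⟩ := by
    have := bipMinusStar_adj_one_last n 2 (by omega)
    simpa using this
  have hE := card_edges_bipMinusStar n 3 1 (by norm_num) (by omega)
  have hS := (sums_bipMinusStar n 3 1 (by norm_num) (by omega)).2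
  have hd1 : deg (bipMinusStar n 3 1) ⟨1, by omega⟩ = n - 3 := by
    have := deg_bipMinusStar_one n 2 (by norm_num) (by omega)
    simpa using this
  have hd2 : deg (bipMinusStar n 3 1) ⟨n - 1, by omega⟩ = 3 := by
    have := deg_bipMinusStar_last n 2 (by norm_num) (by omega)
    simpa using this
  have hE' : (matchingTwo n (by omega)).edgeFinset.card + 1 = (bipMinusStar n 3 1).edgeFinset.card :=
    card_edges_delEdge (bipMinusStar n 3 1) hadj
  have hS' : ∑ v, deg (matchingTwo n (by omega)) v * deg (matchingTwo n (by omega)) v +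
      2 * (deg (bipMinusStar n 3 1) ⟨1, by omega⟩ + deg (bipMinusStar n 3 1) ⟨n - 1, by omega⟩) =
      ∑ v, deg (bipMinusStar n 3 1) v * deg (bipMinusStar n 3 1) v + 2 :=
    sum_deg_sq_delEdge (bipMinusStar n 3 1) hadj
  rw [hd1, hd2] at hS'
  refine ⟨k4mFree_of_le _ _ (delEdge_le _ _ _) (k4mFree_bipMinusStar n 3 1), ?_, ?_⟩
  · omega
  · obtain ⟨S, hSdef⟩ : ∃ S, ∑ v, deg (bipMinusStar n 3 1) v * deg (bipMinusStar n 3 1) v = S := ⟨_, rfl⟩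
    obtain ⟨E, hEdef⟩ : ∃ E, (bipMinusStar n 3 1).edgeFinset.card = E := ⟨_, rfl⟩
    obtain ⟨S', hS'def⟩ : ∃ S', ∑ v, deg (matchingTwo n (by omega)) v * deg (matchingTwo n (by omega)) v = S' :=
      ⟨_, rfl⟩
    obtain ⟨E', hE'def⟩ : ∃ E', (matchingTwo n (by omega)).edgeFinset.card = E' := ⟨_, rfl⟩
    rw [hSdef] at hS hS'
    rw [hEdef] at hE hE'
    rw [hS'def] at hS' ⊢
    rw [hE'def] at hE' ⊢
    obtain ⟨t, rfl⟩ : ∃ t, n = t + 6 := ⟨n - 6, by omega⟩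
    have e1 : t + 6 - 3 = t + 3 := by omega
    have e2 : 2 * (t + 6) - 1 - 1 = 2 * t + 10 := by omega
    have e3 : t + 6 - 1 - 2 = t + 3 := by omega
    rw [e1] at hS hS' hE
    rw [e2] at hS
    rw [e3]
    obtain rfl : E = 3 * t + 8 := by omega
    obtain rfl : E' = 3 * t + 7 := by omega
    nlinarith [hS, hS']

/-- **THE GAP IS ATTAINED:** on every cell `(k, 3, r)`, `r ≥ 1`, `k ≥ r + 7`, some `K₄⁻`-free graph on `Fin k`
with `3 (k − 3) − r` edges has `Σ_v d(v)² + r (k − 1 − r) + secondGapThree k r = m k`. -/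
theorem three_row_second_best_attained (k r : ℕ) (hr : 1 ≤ r) (hk : r + 7 ≤ k) :
    ∃ (D : SimpleGraph (Fin k)) (_ : DecidableRel D.Adj), K4mFree D ∧ D.edgeFinset.card + 9 + r = 3 * k ∧
      ∑ v, deg D v * deg D v + r * (k - 1 - r) + secondGapThree k r = D.edgeFinset.card * k := by
  unfold secondGapThree
  rcases Nat.lt_or_ge r 2 with hr1 | hr2
  · -- `r = 1`: the one-triangle family
    have hr1' : r = 1 := by omega
    subst hr1'
    obtain ⟨n, rfl⟩ : ∃ n, k = n + 1 := ⟨k - 1, by omega⟩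
    obtain ⟨hK, hE, hS, -⟩ := tFamily_value n 1 (le_refl 1) (by omega)
    rw [Fintype.card_fin] at hE hS
    refine ⟨tFamily n 1 (by omega), inferInstance, hK, hE, ?_⟩
    rw [if_pos rfl]
    exact hS
  rcases Nat.lt_or_ge r 3 with hr2' | hr3
  · -- `r = 2`: the matching
    have hr2'' : r = 2 := by omega
    subst hr2''
    obtain ⟨hK, hE, hS⟩ := matchingTwo_value k (by omega)
    refine ⟨matchingTwo k (by omega), inferInstance, hK, hE, ?_⟩
    rw [if_neg (by omega)]
    simpa using hS
  · -- `r ≥ 3`: the broom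
    obtain ⟨D, hD, A, hK, -, -, -, hE, hS⟩ := broom_value k 3 r (by norm_num) hr3 (by omega)
    refine ⟨D, hD, hK, ?_, ?_⟩
    · rw [hE]
      have : r ≤ 3 * (k - 3) := by omega
      omega
    · rw [if_neg (by omega), hE]
      have hmax : max 1 (r - 2) = r - 2 := max_eq_right (by omega)
      rw [hmax]
      exact hS

/-- **THE SECOND-BEST VALUE OF THE ROW `a = 3`:** on every cell `(k, 3, r)` with `r ≥ 1` and `k ≥ r + 7`, every
non-extremal `K₄⁻`-free graph on `Fin k` with `3 (k − 3) − r` edges has `Σ_v d(v)² ≤ m k − r (k − 1 − r) −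
secondGapThree k r`, and the value is attained. -/
theorem three_row_second_best (k r : ℕ) (hr : 1 ≤ r) (hk : r + 7 ≤ k) :
    (∀ (D : SimpleGraph (Fin k)) [DecidableRel D.Adj], K4mFree D → D.edgeFinset.card + 9 + r = 3 * k →
        ∑ v, deg D v * deg D v + r * (k - 1 - r) ≠ D.edgeFinset.card * k →
        ∑ v, deg D v * deg D v + r * (k - 1 - r) + secondGapThree k r ≤ D.edgeFinset.card * k) ∧
      ∃ (D : SimpleGraph (Fin k)) (_ : DecidableRel D.Adj), K4mFree D ∧ D.edgeFinset.card + 9 + r = 3 * k ∧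
        ∑ v, deg D v * deg D v + r * (k - 1 - r) + secondGapThree k r = D.edgeFinset.card * k := by
  refine ⟨?_, three_row_second_best_attained k r hr hk⟩
  intro D _ hK hm hne
  have := three_row_second_best_bound D hK r hr (by simpa using hk) (by simpa using hm) (by simpa using hne)
  simpa using this

end C047

end TriangleCap

end PercRepro
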